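/-
Copyright (c) 2026 the pub-hodgecm-mathlib formalisation cell (harness21).  Prover seat hodgecm-mathlib-K2E3-p20 (g3), Track B «K2-LIT» ∕ h413 =
`stmt-HodgeConjecture-24833`, line `K2_E3_EllipticInputs`, unit U12 «Characters», socket #11 road (SC-an), END-GAME MAP v1 (K2 bus 2026-09-04T02:08:19Z)
brick [M5′]: TRANSPORT of truncated character integrals `∫_{Ω n} θ(x g x⁻¹) dx` along an isomorphism of topological groups `e : G ≃ₜ* M` (pull-back of the
exhaustion, push-forward of the Haar measure, composition of the coefficient), so that the model-side output of ★ [M4] lands on `(cmDatum L 3 H).Local v`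
along ★ (f2) `K2E3RankOneIsotropicPhi3Model`.
-/
import Literature.NumberTheory.Rogawski1990.SupercuspidalNotSphericalCofinite       -- ★ `Representation.IsSupercuspidal.comp_continuousMulEquiv`
import Literature.MeasureTheory.Group.InvariantQuotientOrbitalProd                   -- ★ `mulEquiv_apply_mem_centralizer_singleton_iff`
import Mathlib.MeasureTheory.Measure.Haar.Basic
import Mathlib.MeasureTheory.Integral.Bochner.Set
import HarnessLib

/-!
# K2_E3 road (h413), socket #11 (SC-an), [M5′]: TRANSPORT OF TRUNCATED CHARACTER INTEGRALS ALONG `e : G ≃ₜ* M`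

Cell `pub/hodgecm-mathlib`, Track B «K2-LIT», crux H413 = `stmt-HodgeConjecture-24833` (`--supports … --as helper`, count-neutral).  The Theorem-20 machinery of
the (SC-an) line produces, on the field model `M = U(σ_w, Φ₃)(L_w)`, the two consumer shapes `Θₙ(g′) = ∫_{Ω n ∩ Ω R}` and `Θₙ(g′) → Θ_R(g′)` (★ [M4]
`K2E3SupercuspidalTruncatedCharThm20`); the sockets live on `G = (cmDatum L 3 H).Local v`, reached by ★ (f2) `e : G ≃ₜ* M` (K2E3-p14 (g3)).  Generic `G`, `M`:

* §1 `exists_compactExhaustion_preimage` — the pull-back `Ω′ n = e⁻¹(Ω n)` of a compact exhaustion along a homeomorphism;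
* §2 `setIntegral_preimage_coeff_conj_eq` — `∫_{e⁻¹ S} θ(e(x g x⁻¹)) dμ(x) = ∫_S θ(x′ · e g · x′⁻¹) d(e_* μ)(x′)`; the pair of consumer shapes transports
  (`truncated_eq_inter_and_tendsto_of_map`);
* §3 `isCompact_centralizer_iff_of_continuousMulEquiv` — ellipticity transports; `isSmooth_comp_continuousMulEquiv_symm` — smoothness of `ρ ∘ e⁻¹`
  (supercuspidality ★ `IsSupercuspidal.comp_continuousMulEquiv`); `coeff_comp_symm_apply` — the coefficient of `ρ ∘ e⁻¹` at `e x` is that of `ρ` at `x`.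

HONEST LABEL: HC_CM is proved only modulo the 7 printed citations (2 remaining named inputs: hLiu418 = stmt-HodgeConjecture-24832, h413 =
stmt-HodgeConjecture-24833) until rung 0 closes; this file is a count-neutral helper.

## References
* [HarishChandra1970] Harish-Chandra (notes by G. van Dijk), *Harmonic Analysis on Reductive p-adic Groups*, LNM 162 (1970), Part VII §3 p. 71 eq. (1).
* [Folland1995] G. B. Folland, *A Course in Abstract Harmonic Analysis* (1995), §2.4 (Haar measure under topological isomorphisms).
* [PlatonovRapinchuk1994] V. Platonov, A. Rapinchuk, *Algebraic Groups and Number Theory* (1994), §5.1.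
-/

set_option autoImplicit false
-- the mandated namespace repeats the single-problem summit's segment (`HodgeConjecture.HodgeConjecture`)
set_option linter.dupNamespace false

noncomputable section

open MeasureTheory Measure Set Filter Topology
open scoped Pointwise

namespace Summit.HodgeConjecture.HodgeConjecture.Cruxes.H413.K2E3TruncatedCharTransport

/-! ## §1 Pulling back a compact exhaustion along a homeomorphism -/

/-- **`Ω′ n := e⁻¹(Ω n)` is a compact exhaustion of `G`** for a homeomorphism `e : G ≃ₜ M` and a compact exhaustion `Ω` of `M` (preimages of compacta
under a homeomorphism are compact, `e⁻¹(interior) = interior(e⁻¹)`, `⋃ e⁻¹(Ω n) = e⁻¹(⋃ Ω n) = G`). [cite: PlatonovRapinchuk1994, §5.1] -/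
theorem exists_compactExhaustion_preimage {G M : Type*} [TopologicalSpace G] [TopologicalSpace M] (e : G ≃ₜ M) (Ω : CompactExhaustion M) :
    ∃ Ω' : CompactExhaustion G, ∀ n : ℕ, (Ω' n : Set G) = e ⁻¹' Ω n :=
  ⟨⟨fun n => e ⁻¹' Ω n, fun n => e.isCompact_preimage.2 (Ω.isCompact n), fun n => by
      rw [← e.preimage_interior]
      exact Set.preimage_mono (Ω.subset_interior_succ n), by
      rw [← Set.preimage_iUnion, Ω.iUnion_eq, Set.preimage_univ]⟩, fun _ => rfl⟩

/-! ## §2 Transport of truncated conjugation integrals -/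

section Integral

variable {G M : Type*} [Group G] [TopologicalSpace G] [MeasurableSpace G] [BorelSpace G]
  [Group M] [TopologicalSpace M] [MeasurableSpace M] [BorelSpace M]
  {E : Type*} [NormedAddCommGroup E] [NormedSpace ℝ E]

/-- **`∫_{e⁻¹ S} θ(e(x g x⁻¹)) dμ(x) = ∫_S θ(x′ · e g · x′⁻¹) d(e_* μ)(x′)`** for `e : G ≃ₜ* M` (Mathlib `setIntegral_map_equiv` at the measurable
equivalence underlying `e`; `e(x g x⁻¹) = e x · e g · (e x)⁻¹`). [cite: Folland1995, §2.4] -/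
theorem setIntegral_preimage_coeff_conj_eq (e : G ≃ₜ* M) (μ : Measure G) (θ : M → E) (S : Set M) (g : G) :
    ∫ x in e ⁻¹' S, θ (e (x * g * x⁻¹)) ∂μ = ∫ x' in S, θ (x' * e g * x'⁻¹) ∂(μ.map e) := by
  let em : G ≃ᵐ M := e.toHomeomorph.toMeasurableEquiv
  have hem : ∀ x, em x = e x := fun x => rfl
  have hcoe : (em : G → M) = e := funext hem
  have h := setIntegral_map_equiv (μ := μ) em (fun x' => θ (x' * e g * x'⁻¹)) S
  rw [hcoe] at h
  rw [h]
  exact integral_congr_ae (Eventually.of_forall fun x => by simp only [map_mul, map_inv])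

/-- **THE PAIR OF CONSUMER SHAPES TRANSPORTS** along `e : G ≃ₜ* M`: if on `M`, for `g′ = e g` and the measure `e_* μ`,
`∫_{Ω n} θ(x′ g′ x′⁻¹) = ∫_{Ω n ∩ Ω R} θ(x′ g′ x′⁻¹)` for all `n` and `∫_{Ω n} θ(x′ g′ x′⁻¹) → ∫_{Ω R} θ(x′ g′ x′⁻¹)`, then the same holds on `G` for `g`, `μ`, the pulled-back
exhaustion `Ω′ n = e⁻¹(Ω n)` and the integrand `θ(e(x g x⁻¹))`. [cite: HarishChandra1970, Part VII §3 p. 71 eq. (1)] [cite: Folland1995, §2.4] -/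
theorem truncated_eq_inter_and_tendsto_of_map (e : G ≃ₜ* M) (μ : Measure G) (θ : M → E) (Ω : CompactExhaustion M)
    (Ω' : CompactExhaustion G) (hΩ' : ∀ n : ℕ, (Ω' n : Set G) = e ⁻¹' Ω n) (g : G) {R : ℕ}
    (hcanc : ∀ n : ℕ, ∫ x' in Ω n, θ (x' * e g * x'⁻¹) ∂(μ.map e) = ∫ x' in Ω n ∩ Ω R, θ (x' * e g * x'⁻¹) ∂(μ.map e))
    (hlim : Tendsto (fun n : ℕ => ∫ x' in Ω n, θ (x' * e g * x'⁻¹) ∂(μ.map e)) atTop (𝓝 (∫ x' in Ω R, θ (x' * e g * x'⁻¹) ∂(μ.map e)))) :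
    (∀ n : ℕ, ∫ x in Ω' n, θ (e (x * g * x⁻¹)) ∂μ = ∫ x in Ω' n ∩ Ω' R, θ (e (x * g * x⁻¹)) ∂μ) ∧
      Tendsto (fun n : ℕ => ∫ x in Ω' n, θ (e (x * g * x⁻¹)) ∂μ) atTop (𝓝 (∫ x in Ω' R, θ (e (x * g * x⁻¹)) ∂μ)) := by
  have hS : ∀ n : ℕ, ∫ x in Ω' n, θ (e (x * g * x⁻¹)) ∂μ = ∫ x' in Ω n, θ (x' * e g * x'⁻¹) ∂(μ.map e) := fun n => by
    rw [hΩ', setIntegral_preimage_coeff_conj_eq]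
  have hSS : ∀ n : ℕ, ∫ x in Ω' n ∩ Ω' R, θ (e (x * g * x⁻¹)) ∂μ = ∫ x' in Ω n ∩ Ω R, θ (x' * e g * x'⁻¹) ∂(μ.map e) := fun n => by
    rw [hΩ', hΩ', ← Set.preimage_inter, setIntegral_preimage_coeff_conj_eq]
  refine ⟨fun n => by rw [hS, hSS, hcanc], ?_⟩
  rw [hS R]
  exact hlim.congr fun n => (hS n).symm

end Integral

/-! ## §3 Ellipticity, smoothness, supercuspidality and coefficients along `e` -/

section Structure

variable {G M : Type*} [Group G] [TopologicalSpace G] [Group M] [TopologicalSpace M]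

/-- **`Z(e g) = e(Z(g))` as sets**, for an isomorphism of topological groups `e`. [folklore] -/
theorem coe_centralizer_map_eq_image (e : G ≃ₜ* M) (g : G) :
    ((Subgroup.centralizer ({e g} : Set M) : Subgroup M) : Set M) = e '' ((Subgroup.centralizer ({g} : Set G) : Subgroup G) : Set G) := by
  ext m
  constructor
  · intro hm
    refine ⟨e.symm m, ?_, e.apply_symm_apply m⟩
    have h : e.toMulEquiv (e.symm m) ∈ Subgroup.centralizer ({e.toMulEquiv g} : Set M) := by
      change e (e.symm m) ∈ Subgroup.centralizer ({e g} : Set M)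
      rw [e.apply_symm_apply]; exact hm
    exact (Literature.MeasureTheory.Group.mulEquiv_apply_mem_centralizer_singleton_iff e.toMulEquiv g (e.symm m)).1 h
  · rintro ⟨x, hx, rfl⟩
    exact (Literature.MeasureTheory.Group.mulEquiv_apply_mem_centralizer_singleton_iff e.toMulEquiv g x).2 hx

/-- **Ellipticity transports**: `Z(g)` is compact iff `Z(e g)` is, for an isomorphism of topological groups `e`. [cite: PlatonovRapinchuk1994, §5.1] -/
theorem isCompact_centralizer_iff_of_continuousMulEquiv (e : G ≃ₜ* M) (g : G) :
    IsCompact ((Subgroup.centralizer ({g} : Set G) : Subgroup G) : Set G) ↔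
      IsCompact ((Subgroup.centralizer ({e g} : Set M) : Subgroup M) : Set M) := by
  rw [coe_centralizer_map_eq_image e g]
  exact (e.toHomeomorph.isCompact_image).symm

variable [IsTopologicalGroup G] [IsTopologicalGroup M] {V : Type*} [AddCommGroup V] [Module ℂ V]

omit [IsTopologicalGroup G] [IsTopologicalGroup M] in
/-- **`ρ ∘ e⁻¹` is smooth** when `ρ` is (stabilisers pull back to open subgroups along the continuous `e⁻¹`). [folklore] -/
theorem isSmooth_comp_continuousMulEquiv_symm (e : G ≃ₜ* M) (ρ : Representation ℂ G V) (hρ : ρ.IsSmooth) :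
    Representation.IsSmooth (ρ.comp (e.symm : M →* G)) := by
  intro x
  rw [Representation.isSmoothVector_iff]
  have h := hρ x
  rw [Representation.isSmoothVector_iff] at h
  have heq : (Representation.stabilizerSubgroup (ρ.comp (e.symm : M →* G)) x : Set M) = e.symm ⁻¹' (ρ.stabilizerSubgroup x : Set G) := by
    ext m
    simp only [SetLike.mem_coe, Representation.mem_stabilizerSubgroup, Set.mem_preimage]
    rfl
  rw [heq]
  exact h.preimage e.symm.continuous

/-- **`ρ ∘ e⁻¹` is supercuspidal** when `ρ` is (★ `IsSupercuspidal.comp_continuousMulEquiv`). [cite: HarishChandra1970, Part I §3 p. 9] -/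
theorem isSupercuspidal_comp_continuousMulEquiv_symm (e : G ≃ₜ* M) (ρ : Representation ℂ G V) (hρ : ρ.IsSupercuspidal) :
    Representation.IsSupercuspidal (ρ.comp (e.symm : M →* G)) :=
  hρ.comp_continuousMulEquiv e.symm

omit [TopologicalSpace G] [TopologicalSpace M] [IsTopologicalGroup G] [IsTopologicalGroup M] in
/-- A `ρ`-invariant form is `ρ ∘ e⁻¹`-invariant. [folklore] -/
theorem sesqForm_comp_symm_invariant (e : G ≃* M) (ρ : Representation ℂ G V) (B : V →ₗ⋆[ℂ] V →ₗ[ℂ] ℂ)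
    (hBinv : ∀ (g : G) (x y : V), B (ρ g x) (ρ g y) = B x y) (m : M) (x y : V) :
    B (ρ.comp (e.symm : M →* G) m x) (ρ.comp (e.symm : M →* G) m y) = B x y :=
  hBinv (e.symm m) x y

omit [TopologicalSpace G] [TopologicalSpace M] [IsTopologicalGroup G] [IsTopologicalGroup M] in
/-- **The coefficient of `ρ ∘ e⁻¹` at `e x` is the coefficient of `ρ` at `x`.** [folklore] -/
theorem coeff_comp_symm_apply (e : G ≃* M) (ρ : Representation ℂ G V) (B : V →ₗ⋆[ℂ] V →ₗ[ℂ] ℂ) (u u' : V) (x : G) :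
    B u' (ρ.comp (e.symm : M →* G) (e x) u) = B u' (ρ x u) := by
  change B u' (ρ (e.symm (e x)) u) = B u' (ρ x u)
  rw [e.symm_apply_apply]

end Structure

end Summit.HodgeConjecture.HodgeConjecture.Cruxes.H413.K2E3TruncatedCharTransport

end
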